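import Summits.HodgeConjecture.HodgeConjecture.Theorems.NikulinTwinTransportRealMultiplicationGlue
import Summits.HodgeConjecture.HodgeConjecture.Theorems.NikulinTwinTransportRealMultiplicationHodgeTypes

/-!
# Route NikulinTwinTransport · `RealMultiplicationGlue` (stmt-HodgeConjecture-13681) —
# the glue from markings ALONE: the Hodge types of `H²(K3)` are read off `e` itself

The sibling file `NikulinTwinTransportRealMultiplicationGlue` proves the route's glue item
`RealMultiplicationGlue := TwinSimilitudeAlgebraic → HodgeIsometryAlgebraic → TwinExists →
LefschetzOneOneK3 → RealMultiplicationSqrtTwoAlgebraic` from TWO named K3 facts, markings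
(`Huybrechts_K3_marking_exists`, Huybrechts Ch. 1 Prop. 3.5) and the Hodge types of `H²(K3)`
(`Huybrechts_K3_hodgeTypes_H2`, Ch. 6 Prop. 1.2: `H^{1,1} = ⟨σ, σ̄⟩^⊥`), by the mirror trick
`e = ½ (Ξ₁ − Ξ₂)`, `Ξ₁ = e + ν̃`, `Ξ₂ = −e + ν̃` (two rational Hodge `2`-similitudes of `H²(S)`,
algebraic by X at the pair `(S, S)`). This file REMOVES the second fact. The `(1,1)`-bookkeeping it
served is obtained from the endomorphism `e` and the uniqueness of the Hodge decomposition of a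
Hodge model (field `HodgeModel.isInternal_hodgePQ`), with no statement about cup products of types:

* the `(2,0)`-line `H^{2,0} = ℂσ` is a clause of the marking fact, and the `(0,2)`-line
  `H^{0,2} = ℂσ̄` follows (`isOfHodgeType_swap_iff_of_line`, unconditional in the tree); hence every
  class decomposes as `y = aσ + y₁₁ + bσ̄` with `y₁₁` of type `(1,1)` (`exists_eq_lines_add_oneOne`);
* `eσ = λσ`, `eσ̄ = λσ̄` (one `λ`: self-adjointness and `(σ.σ̄) ≠ 0`);
* DEGENERATE CASE `λ = 0`: `e y = e y₁₁` is of type `(1,1)` for EVERY `y`, so (Lefschetz `(1,1)`,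
  the glue's fourth hypothesis) `e ∘ e = 0` on rational classes, hence everywhere, hence `NS^⊥ = 0`
  and `e = 0 = [0]_*`;
* MAIN CASE `λ ≠ 0`: every class killed by `e` is of type `(1,1)` (`isOfHodgeType_oneOne_of_ker`):
  from `0 = e d = aλσ + e d₁₁ + bλσ̄` and the independence of `H^{2,0}, H^{1,1}, H^{0,2}` in a model
  (`hodgeModel_eq_zero_of_add_add_eq_zero`), `a = b = 0`. In particular the divisor classes
  `η⁻¹aᵢ, η⁻¹bᵢ ∈ NS = algebraicClasses S 1` carrying the Witt correction `ν̃` are of type `(1,1)`,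
  which is all the type-preservation of `Ξ₁, Ξ₂` needs (`isOfHodgeType_add_correction_of_oneOne`;
  the `(2,0)` / `(0,2)` classes are killed by `ν̃` because `NS ⊥ σ, σ̄`, again from `e`:
  `λ (d.σ) = (d.eσ) = (ed.σ) = 0`).

Results: the per-surface core `realMultiplicationSqrtTwo_algebraic_of_markedK3` (a MARKED projective
K3 surface, X at `(S, S)`, Lefschetz `(1,1)` on `S` ⟹ real multiplication by `√2` is algebraic;
unconditional), `realMultiplicationGlue_of_marking : Huybrechts_K3_marking_exists →
RealMultiplicationGlue`, and `assembly_of_squareGlue_of_marking` for the frame item. WHY THE MARKING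
STAYS: any rational,
type-preserving `2`-similitude `Ξ` of `H²(S)` restricts to `NS_ℚ(2) ≅ NS_ℚ`, and conversely the
mirror trick needs one; given `e` (`T_ℚ(2) ≅ T_ℚ`) this is equivalent, by Witt cancellation, to
`H²(S, ℚ)(2) ≅ H²(S, ℚ)` as quadratic spaces — a property of the K3 lattice (`U_ℚ(2) ≅ U_ℚ`,
`E₈(2) ↪ E₈`, the tree's `exists_twoSimilitude_k3FormRat`) which none of the glue's four
hypotheses supplies: X, Buskin and the universal twin only relate `S` to OTHER surfaces
(`H²(S′, ℚ)(2) ≅ H²(S, ℚ)`), and Lefschetz `(1,1)` says nothing about the form. So in the tree's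
vocabulary the item is exactly as strong as "marking ⟹ glue"; the marking fact itself is reduced in
`Literature/AlgebraicGeometry/Surfaces/K3MarkingProofs` to `b₂ = 22`, evenness, index `−16`,
`h^{2,0} ≤ 1` and the two positivity statements (Milnor's theorem and the lattice theory being
proved there).
Prover seat prover-pitem-stmt-HodgeConjecture-13681-1.
-/

noncomputable section

namespace Summit.HodgeConjecture.HodgeConjecture.Theorems.NikulinTwinTransport

open scoped Manifold
open CategoryTheory MonoidalCategory
open Literature.AlgebraicGeometry.Motives Literature.AlgebraicGeometry.HodgeTheory
open Literature.AlgebraicGeometry.Surfaces Literature.Geometry.Kaehler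
open Literature.AlgebraicTopology.SingularHomology

section Marked

variable {S : SchemeOver ℂ}

/-! ### The reduction from a marking alone -/

/-- **Real multiplication by `√2` on ONE MARKED projective K3 surface `S` is algebraic, granted X at
the pair `(S, S)` and Lefschetz `(1,1)` on `S`.** The marking data are exactly the clauses of
`Huybrechts_K3_marking_exists` at `S` that are used: `η : H²(S(ℂ); ℂ) ≅ Λ_ℂ` with integral classes
`↔ Λ`, `a ∪ b = (ηa.ηb) p₀` for an integral generator `p₀ ≠ 0` of `H⁴`, a `(2,0)`-class `σ = η⁻¹x₀`
spanning the `(2,0)`-classes, and `re (x̄₀.x₀) > 0`. The Hodge types of `H²(S)` are read off `e`: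
`eσ = λσ`, `eσ̄ = λσ̄`. CASE `λ = 0`: for every
`y = aσ + y₁₁ + bσ̄` (`exists_eq_lines_add_oneOne`), `e y = e y₁₁` is of type `(1,1)`, so
`e (e x) = 0` for rational `x` (Lefschetz `(1,1)`, `e|_{NS} = 0`), hence for all `x` (rational
classes span), hence `NS^⊥ = 0` (`e² = 2` there) and `e = 0 = [0]_*`. CASE `λ ≠ 0`: `NS ⊥ σ, σ̄`
(`λ(d.σ) = (ed.σ) = 0`) and `NS ⊆ H^{1,1}` (`isOfHodgeType_oneOne_of_ker`); the Witt correction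
`ν̃ = Σᵢ (η·.aᵢ) η⁻¹bᵢ` of `exists_ratCorrection` (`η⁻¹aᵢ, η⁻¹bᵢ ∈ NS`) makes `Ξ₁ = e + ν̃` and its
mirror `Ξ₂ = −e + ν̃` rational, type-preserving `2`-similitudes of `H²(S)`
(`isRationalClass_add_correction`, `isOfHodgeType_add_correction_of_oneOne`,
`cupProduct_add_correction`, `cupProduct_neg_add_correction_eq`); X at `(S, S)` gives algebraic
`γ₁, γ₂` with `Ξᵢ = [γᵢ]_*`, and `e = ½(Ξ₁ − Ξ₂) = [½(γ₁ − γ₂)]_*`.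
[cite: Varesco2023, Thm. 2.1 and Rem. 2.2] [cite: Huybrechts2019, §1]
[cite: Huybrechts2016K3, Ch. 1 Prop. 3.5; Ch. 3 Def. 2.3] -/
theorem realMultiplicationSqrtTwo_algebraic_of_markedK3
    (μ : OrientationFamily) (S : SchemeOver ℂ) (hS : IsK3Surface S)
    (η : complexBetti S (2 * 1) ≃ₗ[ℂ] (K3Index → ℂ)) (p₀ : complexBetti S (2 * 2)) (x₀ : K3Index → ℂ)
    (hp₀ : p₀ ≠ 0) (hp₀int : IsIntegralClass p₀)
    (hp₀gen : ∀ q : complexBetti S (2 * 2), IsIntegralClass q → ∃ n : ℤ, q = n • p₀)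
    (hηint : ∀ c : complexBetti S (2 * 1), IsIntegralClass c ↔ ∃ v : K3Index → ℤ, η c = fun i => (v i : ℂ))
    (hηcup : ∀ a b : complexBetti S (2 * 1),
      cupProduct (rfl : 2 * 1 + 2 * 1 = 2 * 2) a b = k3Form (η a) (η b) • p₀)
    (h20 : IsOfHodgeType 2 S (2 * 1) 2 0 (η.symm x₀))
    (hspan : ∀ τ : complexBetti S (2 * 1), IsOfHodgeType 2 S (2 * 1) 2 0 τ → ∃ t : ℂ, τ = t • η.symm x₀)
    (hxpos : 0 < (k3Form (star x₀) x₀).re)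
    (hL : ∀ c : complexBetti S (2 * 1), IsRationalClass c → IsOfHodgeType 2 S (2 * 1) 1 1 c →
      c ∈ algebraicClasses S 1)
    (hX : ∀ (p : complexBetti S (2 * 2)),
      (IsIntegralClass p ∧ ∀ q : complexBetti S (2 * 2), IsIntegralClass q → ∃ n : ℤ, q = n • p) →
      ∀ (ψ : complexBetti S (2 * 1) →ₗ[ℂ] complexBetti S (2 * 1)),
        (∀ x, IsRationalClass x → IsRationalClass (ψ x)) →
        (∀ (i j : ℕ) x, IsOfHodgeType 2 S (2 * 1) i j x → IsOfHodgeType 2 S (2 * 1) i j (ψ x)) →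
        (∀ (x y : complexBetti S (2 * 1)) (a : ℂ),
          cupProduct (rfl : 2 * 1 + 2 * 1 = 2 * 2) x y = a • p →
            cupProduct (rfl : 2 * 1 + 2 * 1 = 2 * 2) (ψ x) (ψ y) = ((2 : ℂ) * a) • p) →
        ∃ γ ∈ algebraicClasses (S ⊗ S) 2, ∀ x : complexBetti S (2 * 1),
          ψ x = complexGysin μ (IsSmoothProjective.tensor_holds hS.1 hS.1) hS.1
            (SemiCartesianMonoidalCategory.fst S S)
            (rfl : 2 * 1 + 2 * 2 + 2 * 2 = 2 * 1 + 2 * (2 + 2))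
            (cupProduct (rfl : 2 * 1 + 2 * 2 = 2 * 1 + 2 * 2)
              (complexBetti.map (SemiCartesianMonoidalCategory.snd S S) (2 * 1) x) γ))
    (e : complexBetti S (2 * 1) →ₗ[ℂ] complexBetti S (2 * 1))
    (he_rat : ∀ x, IsRationalClass x → IsRationalClass (e x))
    (he_type : ∀ (i j : ℕ) x, IsOfHodgeType 2 S (2 * 1) i j x → IsOfHodgeType 2 S (2 * 1) i j (e x))
    (he_adj : ∀ x y : complexBetti S (2 * 1),
      cupProduct (rfl : 2 * 1 + 2 * 1 = 2 * 2) (e x) y = cupProduct (rfl : 2 * 1 + 2 * 1 = 2 * 2) x (e y))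
    (he_N : ∀ d ∈ algebraicClasses S 1, e d = 0)
    (he_T : ∀ x : complexBetti S (2 * 1),
      (∀ d ∈ algebraicClasses S 1, cupProduct (rfl : 2 * 1 + 2 * 1 = 2 * 2) x d = 0) →
        e (e x) = (2 : ℂ) • x) :
    ∃ γ ∈ algebraicClasses (S ⊗ S) 2, ∀ x : complexBetti S (2 * 1),
      e x = complexGysin μ (IsSmoothProjective.tensor_holds hS.1 hS.1) hS.1
        (SemiCartesianMonoidalCategory.fst S S)
        (rfl : 2 * 1 + 2 * 2 + 2 * 2 = 2 * 1 + 2 * (2 + 2))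
        (cupProduct (rfl : 2 * 1 + 2 * 2 = 2 * 1 + 2 * 2)
          (complexBetti.map (SemiCartesianMonoidalCategory.snd S S) (2 * 1) x) γ) := by
  -- the `(2,0)`-class `σ = η⁻¹x₀` of the marking and the two lines
  obtain ⟨A⟩ := hS.nonempty_hodgeModel
  have hσ0 : η.symm x₀ ≠ 0 := fun h0 =>
    ne_zero_of_star_self_re_pos hxpos (by simpa using congrArg η h0)
  have hσ'0 : η.symm (star x₀) ≠ 0 := fun h0 =>
    ne_zero_of_star_self_re_pos hxpos (by simpa using congrArg η h0)
  have h1 : ∀ c : complexBetti S (2 * 1), IsOfHodgeType 2 S (2 * 1) 2 0 c ↔ ∃ t : ℂ, c = t • η.symm x₀ :=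
    fun c => ⟨hspan c, fun ⟨t, ht⟩ => ht ▸ h20.smul t⟩
  have h2 : ∀ c : complexBetti S (2 * 1),
      IsOfHodgeType 2 S (2 * 1) 0 2 c ↔ ∃ t : ℂ, c = t • η.symm (star x₀) := fun c => by
    have h := isOfHodgeType_swap_iff_of_line hS.1 (p := 2) (q := 0) h1 c
    rwa [conjClass_marking_symm η hηint] at h
  have h02 : IsOfHodgeType 2 S (2 * 1) 0 2 (η.symm (star x₀)) := (h2 _).2 ⟨1, (one_smul ℂ _).symm⟩
  -- `e σ = l σ`, `e σ̄ = l' σ̄`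
  obtain ⟨l, hl⟩ := (h1 (e (η.symm x₀))).1 (he_type 2 0 _ h20)
  obtain ⟨l', hl'⟩ := (h2 (e (η.symm (star x₀)))).1 (he_type 0 2 _ h02)
  -- `(σ.σ̄) ≠ 0`, hence `l = l'`
  have hσσ' : cupProduct (rfl : 2 * 1 + 2 * 1 = 2 * 2) (η.symm x₀) (η.symm (star x₀)) =
      k3Form x₀ (star x₀) • p₀ := by
    rw [hηcup, LinearEquiv.apply_symm_apply, LinearEquiv.apply_symm_apply]
  have hk : k3Form x₀ (star x₀) ≠ 0 := by
    rw [k3Form_comm]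
    intro h0
    rw [h0, Complex.zero_re] at hxpos
    exact lt_irrefl _ hxpos
  have hll' : l = l' := by
    have h := he_adj (η.symm x₀) (η.symm (star x₀))
    rw [hl, hl', LinearMap.map_smul₂, LinearMap.map_smul, hσσ', smul_smul, smul_smul] at h
    exact mul_right_cancel₀ hk (smul_left_injective ℂ hp₀ h)
  by_cases hl0 : l = 0
  · /- DEGENERATE CASE `e σ = e σ̄ = 0`: then `e = 0`. -/
    have heσ : e (η.symm x₀) = 0 := by rw [hl, hl0, zero_smul]
    have heσ' : e (η.symm (star x₀)) = 0 := by rw [hl', ← hll', hl0, zero_smul]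
    -- every `e y = e y₁₁` is of type `(1,1)`
    have h11 : ∀ y, IsOfHodgeType 2 S (2 * 1) 1 1 (e y) := fun y => by
      obtain ⟨a, b, y₁₁, hy₁₁, hy⟩ := exists_eq_lines_add_oneOne hS.1 A h1 h2 y
      rw [hy, map_add, map_add, map_smul, map_smul, heσ, heσ', smul_zero, smul_zero, zero_add,
        add_zero]
      exact he_type 1 1 _ hy₁₁
    -- so `e (e x) = 0` for rational `x` (Lefschetz (1,1): `e x ∈ NS`), hence for all `x`
    have hee_rat : ∀ x, IsRationalClass x → e (e x) = 0 := fun x hx =>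
      he_N _ (hL (e x) (he_rat x hx) (h11 x))
    have hee : ∀ x, e (e x) = 0 := by
      intro x
      have hx : x = ∑ j, (η x) j • η.symm (fun i => ((Pi.single j (1 : ℤ) : K3Index → ℤ) i : ℂ)) := by
        apply η.injective
        rw [map_sum]
        simp_rw [map_smul, LinearEquiv.apply_symm_apply]
        exact pi_eq_sum_single (η x)
      rw [hx, map_sum, map_sum]
      refine Finset.sum_eq_zero fun j _ => ?_
      rw [map_smul, map_smul,
        hee_rat _ ((hηint _).2 ⟨Pi.single j 1, η.apply_symm_apply _⟩).isRationalClass, smul_zero]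
    -- `NS^⊥ = 0`
    have hT0 : ∀ x : complexBetti S (2 * 1),
        (∀ d ∈ algebraicClasses S 1, cupProduct (rfl : 2 * 1 + 2 * 1 = 2 * 2) x d = 0) → x = 0 := by
      intro x hx
      have h := he_T x hx
      rw [hee] at h
      exact (smul_eq_zero.1 h.symm).resolve_left two_ne_zero
    -- `e x ∈ NS^⊥`, so `e = 0`
    have he0 : ∀ x, e x = 0 := fun x =>
      hT0 (e x) fun d hd => by rw [he_adj, he_N d hd, map_zero]
    refine ⟨0, Submodule.zero_mem _, fun x => ?_⟩
    rw [he0, map_zero, map_zero]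
  · /- MAIN CASE `l ≠ 0`: `NS ⊥ σ, σ̄`, `NS ⊆ H^{1,1}`, Witt correction, X twice, `e = ½(Ξ₁ − Ξ₂)`. -/
    have hl'0 : l' ≠ 0 := hll' ▸ hl0
    have horth : ∀ d ∈ algebraicClasses S 1,
        cupProduct (rfl : 2 * 1 + 2 * 1 = 2 * 2) d (η.symm x₀) = 0 ∧
          cupProduct (rfl : 2 * 1 + 2 * 1 = 2 * 2) d (η.symm (star x₀)) = 0 := by
      intro d hd
      refine ⟨?_, ?_⟩
      · have h := he_adj d (η.symm x₀)
        rw [he_N d hd, map_zero, LinearMap.zero_apply, hl, LinearMap.map_smul] at h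
        exact (smul_eq_zero.1 h.symm).resolve_left hl0
      · have h := he_adj d (η.symm (star x₀))
        rw [he_N d hd, map_zero, LinearMap.zero_apply, hl', LinearMap.map_smul] at h
        exact (smul_eq_zero.1 h.symm).resolve_left hl'0
    have horth' : ∀ w : K3Index → ℚ, η.symm (fun j => (w j : ℂ)) ∈ algebraicClasses S 1 →
        k3Form (fun j => (w j : ℂ)) x₀ = 0 ∧ k3Form (fun j => (w j : ℂ)) (star x₀) = 0 := by
      intro w hw
      obtain ⟨hw1, hw2⟩ := horth _ hw
      rw [hηcup, LinearEquiv.apply_symm_apply, LinearEquiv.apply_symm_apply, smul_eq_zero] at hw1 hw2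
      exact ⟨hw1.resolve_right hp₀, hw2.resolve_right hp₀⟩
    -- divisor classes are of type `(1,1)`: they are killed by `e`
    have hN11 : ∀ d ∈ algebraicClasses S 1, IsOfHodgeType 2 S (2 * 1) 1 1 d := fun d hd =>
      isOfHodgeType_oneOne_of_ker hS.1 A h20 hσ0 h02 hσ'0 h1 h2 e he_type hl hl' hl0 hl'0 (he_N d hd)
    -- the rational correction (Witt)
    obtain ⟨m, a, b, ξ, ha, hb, hξ, hKB⟩ :=
      exists_ratCorrection hS η p₀ hp₀ hηint hηcup e he_rat he_adj he_N he_T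
    -- the correction `ν̃ = Σᵢ (η(·).aᵢ) η⁻¹bᵢ`
    set ψ : Fin m → (complexBetti S (2 * 1) →ₗ[ℂ] complexBetti S (2 * 1)) := fun i =>
      ((k3FormC.flip fun j => (a i j : ℂ)) ∘ₗ η.toLinearMap).smulRight (η.symm fun j => (b i j : ℂ))
      with hψdef
    have hψ : ∀ i x, ψ i x = k3Form (η x) (fun j => (a i j : ℂ)) • η.symm (fun j => (b i j : ℂ)) := by
      intro i x
      rw [hψdef]
      change ((k3FormC.flip fun j => (a i j : ℂ)) ∘ₗ η.toLinearMap) x • η.symm (fun j => (b i j : ℂ)) = _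
      rw [LinearMap.comp_apply, LinearEquiv.coe_coe, LinearMap.BilinForm.flip_apply, k3FormC_apply]
    set ν : complexBetti S (2 * 1) →ₗ[ℂ] complexBetti S (2 * 1) := ∑ i, ψ i with hνdef
    have hν : ∀ x, ν x = ∑ i, k3Form (η x) (fun j => (a i j : ℂ)) • η.symm (fun j => (b i j : ℂ)) := by
      intro x
      rw [hνdef, LinearMap.sum_apply]
      exact Finset.sum_congr rfl fun i _ => hψ i x
    have heb : ∀ i, e (η.symm fun j => (b i j : ℂ)) = 0 := fun i => he_N _ (hb i)
    have hrat₁ := isRationalClass_add_correction hS η hηint e ν a b ξ hν hKB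
    have hcup₁ := cupProduct_add_correction η p₀ hp₀ hηcup e ν a b ξ hν hKB hξ
    -- X at the pair `(S, S)` for `Ξ₁ = e + ν̃`
    obtain ⟨γ₁, hγ₁, hΞ₁⟩ := hX p₀ ⟨hp₀int, hp₀gen⟩ (e + ν) hrat₁
      (isOfHodgeType_add_correction_of_oneOne hS η x₀ h1 h2 e ν he_type a b hν
        (fun i => horth' _ (ha i)) (fun i => hN11 _ (hb i)))
      hcup₁
    -- X at the pair `(S, S)` for the mirror `Ξ₂ = -e + ν̃`
    obtain ⟨γ₂, hγ₂, hΞ₂⟩ := hX p₀ ⟨hp₀int, hp₀gen⟩ (-e + ν)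
      (fun x hx => by
        have hx2 : (-e + ν) x = (e + ν) x + ((-2 : ℚ) : ℂ) • e x := by
          rw [LinearMap.add_apply, LinearMap.neg_apply, LinearMap.add_apply, Rat.cast_neg,
            Rat.cast_ofNat]
          module
        rw [hx2]
        exact (hrat₁ x hx).add ((he_rat x hx).smul _))
      (isOfHodgeType_add_correction_of_oneOne hS η x₀ h1 h2 (-e) ν
        (fun i j x hx => by rw [LinearMap.neg_apply]; exact isOfHodgeType_neg (he_type i j x hx))
        a b hν (fun i => horth' _ (ha i)) (fun i => hN11 _ (hb i)))
      (fun x y c hxy => by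
        rw [cupProduct_neg_add_correction_eq η e ν he_adj a b hν heb x y]
        exact hcup₁ x y c hxy)
    -- `e = ½ (Ξ₁ − Ξ₂)`
    have h := induced_smul (IsSmoothProjective.tensor_holds hS.1 hS.1) hS.1
      (rfl : 2 * 1 + 2 * 2 = 2 * 1 + 2 * 2) (rfl : 2 * 1 + 2 * 2 + 2 * 2 = 2 * 1 + 2 * (2 + 2))
      (1 / 2 : ℂ)
      (induced_sub (IsSmoothProjective.tensor_holds hS.1 hS.1) hS.1
        (rfl : 2 * 1 + 2 * 2 = 2 * 1 + 2 * 2) (rfl : 2 * 1 + 2 * 2 + 2 * 2 = 2 * 1 + 2 * (2 + 2))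
        ⟨γ₁, hγ₁, hΞ₁⟩ ⟨γ₂, hγ₂, hΞ₂⟩)
    have he : (1 / 2 : ℂ) • ((e + ν) - (-e + ν)) = e := by
      rw [show (e + ν) - (-e + ν) = (2 : ℂ) • e by module, smul_smul]
      norm_num
    rwa [he] at h

/-- **Real multiplication by `√2` on projective K3 surfaces is algebraic (the route decl
`RealMultiplicationSqrtTwoAlgebraic`), granted X = Sim₂(K3) (used at the pairs `(S, S)` only),
Lefschetz `(1,1)` for K3 surfaces and markings (`Huybrechts_K3_marking_exists`)** —
`realMultiplicationSqrtTwo_algebraic_of_markedK3` surface by surface, the marking of each `S` being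
supplied by the named fact.
[cite: Varesco2023, Thm. 2.1 and Rem. 2.2] [cite: Huybrechts2019, §1] -/
theorem realMultiplicationSqrtTwoAlgebraic_of_marking
    (hX : Theses.NikulinTwinTransport.TwinSimilitudeAlgebraic)
    (hL : Theses.NikulinTwinTransport.LefschetzOneOneK3)
    (hmark : Huybrechts_K3_marking_exists) :
    Theses.NikulinTwinTransport.RealMultiplicationSqrtTwoAlgebraic :=
  fun μ hμ S hS e he_rat he_type he_adj he_N he_T => by
    obtain ⟨η, p₀, x₀, hp₀, ⟨hp₀int, hp₀gen, hηint, hηcup, h20, hspan⟩, ⟨-, hxpos, -⟩⟩ := hmark S hS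
    exact realMultiplicationSqrtTwo_algebraic_of_markedK3 μ S hS η p₀ x₀ hp₀ hp₀int hp₀gen hηint hηcup
      h20 hspan hxpos (hL S hS) (fun p hp ψ => hX μ hμ S S hS hS p p hp hp ψ) e he_rat he_type he_adj
      he_N he_T

end Marked

/-- **The route's glue `RealMultiplicationGlue` (item stmt-HodgeConjecture-13681,
`TwinSimilitudeAlgebraic → HodgeIsometryAlgebraic → TwinExists → LefschetzOneOneK3 →
RealMultiplicationSqrtTwoAlgebraic`) from markings ALONE** (`Huybrechts_K3_marking_exists`,
Huybrechts Ch. 1 Prop. 3.5 with the period clauses): of the glue's hypotheses, X and Lefschetz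
`(1,1)` are used; Buskin's theorem and the universal twin are not; the Hodge types of `H²(K3)`
(`Huybrechts_K3_hodgeTypes_H2`), the bigrading of the cup product, divisor correspondences and the
coniveau fact do not enter. [cite: Varesco2023, Thm. 2.1 and Rem. 2.2] [cite: Huybrechts2019, §1]
[cite: Huybrechts2016K3, Ch. 1 Prop. 3.5] -/
theorem realMultiplicationGlue_of_marking (hmark : Huybrechts_K3_marking_exists) :
    Theses.NikulinTwinTransport.RealMultiplicationGlue :=
  fun hX _ _ hL => realMultiplicationSqrtTwoAlgebraic_of_marking hX hL hmark

/-- **The route's frame item `Assembly` (stmt-HodgeConjecture-13942, `TwinSimilitudeAlgebraic →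
HodgeIsometryAlgebraic → TwinExists → LefschetzOneOneK3 → SectorComplement → HodgeConjecture`)
from `SquareGlue` and markings alone.** [cite: Varesco2023, Thm. 2.1 and Rem. 2.2] -/
theorem assembly_of_squareGlue_of_marking
    (hSq : Theses.NikulinTwinTransport.SquareGlue) (hmark : Huybrechts_K3_marking_exists) :
    Theses.NikulinTwinTransport.Assembly :=
  fun hX _ _ h₁ h₇ => h₇ (hSq (realMultiplicationSqrtTwoAlgebraic_of_marking hX h₁ hmark) h₁)

end Summit.HodgeConjecture.HodgeConjecture.Theorems.NikulinTwinTransport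

end
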